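import Summits.AtomisticToContinuum.HydrodynamicLimit.Theorems.BoltzmannGreenKubo.Negative.AllWindows

/-!
# Kinetic-window variance: ceiling and block sub-convexity (helper file 1/3 for
# `OneFlightGossipEngine.EquilibriumStressVarianceDecay`, stmt-AtomisticToContinuum-9531)

Infrastructure for the reduction `FluxGibbsianityLdDrude.FastObservableMeanErgodic →
OneFlightGossipEngine.EquilibriumStressVarianceDecay` (prover of item 9531), for the
constant-profile local Gibbs law `G_N = localGibbsLaw σ c u θ N Φ` (flow-invariant,
`BoltzmannGreenKuboOrthMomentum.map_flow_localGibbsLaw_const`) and a square-integrable phase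
function `X`, with the window functional `W(h) = ∫⁻ ofReal((h⁻¹∫₀ʰ X(Φ_r z) dr)²) dG_N`:

* `lintegral_sq_window_le` — the CEILING `W(h) ≤ ∫⁻ ofReal(X²) dG_N` (Jensen in time + stationarity;
  the `L²` version of `BoltzmannGreenKuboOrthMomentum.integral_sq_window_le`, which assumed `X`
  bounded and velocity-only);
* `lintegral_sq_window_le_of_le_of_le` — BLOCK SUB-CONVEXITY: for `k h₀ ≤ h ≤ (k+1) h₀`,
  `W(h) ≤ 2 W(h₀) + (2/k²) ∫⁻ ofReal(X²) dG_N` (split `[0,h]` into `k` blocks of length `h₀` and a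
  remainder, shift each block back with the group property on the good set, Cauchy–Schwarz, and
  integrate using invariance) — this is what upgrades an `∃ τ` statement (FastObservableMeanErgodic)
  to `τ → ∞` (EquilibriumStressVarianceDecay).

The static second moment `∫⁻ ofReal(X²) dG_N` of the weighted one-body sums `X = Σᵢ χ(xᵢ) g(vᵢ)` is
bounded in the companion file `…EquilibriumStressVarianceDecayStatics`. All statements are for every
`N`, every flow and every window; no dynamics beyond invariance and the group property is used.
References: the module docstrings of
`Theorems/BoltzmannGreenKubo/Negative/{TimeAverage,Stationarity,AllWindows}.lean` (H. Spohn, *Large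
Scale Dynamics of Interacting Particles* (1991), Part I §2.3 for the invariance of equilibrium
measures).
-/

noncomputable section

namespace Summit.AtomisticToContinuum.HydrodynamicLimit.Theorems

open MeasureTheory ProbabilityTheory Filter Topology Set
open Literature.Analysis.FluidPDE Literature.MathematicalPhysics.KineticTheory
open scoped InnerProductSpace ENNReal
open BoltzmannGreenKuboOrthMomentum

namespace EquilibriumStressVarianceDecayC3

section Ceiling

variable {σ : ℝ} {N : ℕ}

/-- **The kinetic-window variance never exceeds the static second moment** (`L²` version, `lintegral`
form): for `X ∈ L²(G_N)` measurable and `h > 0`,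
`∫⁻ ofReal((h⁻¹∫₀ʰ X(Φ_r z) dr)²) dG_N ≤ ∫⁻ ofReal(X²) dG_N` (Jensen in time a.e. + stationary time
averages). [folklore] -/
theorem lintegral_sq_window_le (c θ : ℝ) (u : V3)
    (Φ : HardSphereFlow (Torus.geometry (Fin 3)) (hsDiameter σ N) (N + 1))
    [IsProbabilityMeasure (localGibbsLaw σ (fun _ => c) (fun _ => u) (fun _ => θ) N Φ)]
    {X : Config (N + 1) (Fin 3) T3 → ℝ} (hX : Measurable X)
    (hX2 : MemLp X 2 (localGibbsLaw σ (fun _ => c) (fun _ => u) (fun _ => θ) N Φ))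
    {h : ℝ} (hh : 0 < h) :
    ∫⁻ z, ENNReal.ofReal ((h⁻¹ * ∫ r in (0 : ℝ)..h, X (Φ.flow r z)) ^ 2)
        ∂(localGibbsLaw σ (fun _ => c) (fun _ => u) (fun _ => θ) N Φ) ≤
      ∫⁻ z, ENNReal.ofReal (X z ^ 2) ∂(localGibbsLaw σ (fun _ => c) (fun _ => u) (fun _ => θ) N Φ) := by
  set G := localGibbsLaw σ (fun _ => c) (fun _ => u) (fun _ => θ) N Φ with hGdef
  have hXi : Integrable X G := hX2.integrable one_le_two
  have hX2m : Measurable fun w => X w ^ 2 := hX.pow_const 2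
  have hX2i : Integrable (fun w => X w ^ 2) G := hX2.integrable_sq
  have hsec : ∀ᵐ z ∂G, Integrable (fun r => X (Φ.flow r z)) (volume.restrict (Ioc (0 : ℝ) h)) :=
    (integrable_comp_flow_prod c θ u Φ hX hXi h).prod_left_ae
  have hsec2 : ∀ᵐ z ∂G, Integrable (fun r => X (Φ.flow r z) ^ 2) (volume.restrict (Ioc (0 : ℝ) h)) :=
    (integrable_comp_flow_prod c θ u Φ hX2m hX2i h).prod_left_ae
  have hpt : ∀ᵐ z ∂G, ENNReal.ofReal ((h⁻¹ * ∫ r in (0 : ℝ)..h, X (Φ.flow r z)) ^ 2) ≤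
      ENNReal.ofReal (h⁻¹ * ∫ r in (0 : ℝ)..h, X (Φ.flow r z) ^ 2) := by
    filter_upwards [hsec, hsec2] with z hz hz2
    refine ENNReal.ofReal_le_ofReal (sq_avg_le_avg_sq hh ?_ ?_)
    · rw [intervalIntegrable_iff_integrableOn_Ioc_of_le hh.le]; exact hz
    · rw [intervalIntegrable_iff_integrableOn_Ioc_of_le hh.le]; exact hz2
  have hwin2 : Integrable (fun z => ∫ r in (0 : ℝ)..h, X (Φ.flow r z) ^ 2) G :=
    integrable_window c θ u Φ hX2m hX2i hh.le
  have hnn : ∀ z, 0 ≤ h⁻¹ * ∫ r in (0 : ℝ)..h, X (Φ.flow r z) ^ 2 := fun z =>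
    mul_nonneg (inv_nonneg.2 hh.le) (intervalIntegral.integral_nonneg hh.le fun r _ => sq_nonneg _)
  calc ∫⁻ z, ENNReal.ofReal ((h⁻¹ * ∫ r in (0 : ℝ)..h, X (Φ.flow r z)) ^ 2) ∂G
      ≤ ∫⁻ z, ENNReal.ofReal (h⁻¹ * ∫ r in (0 : ℝ)..h, X (Φ.flow r z) ^ 2) ∂G := lintegral_mono_ae hpt
    _ = ENNReal.ofReal (∫ z, h⁻¹ * (∫ r in (0 : ℝ)..h, X (Φ.flow r z) ^ 2) ∂G) :=
        (ofReal_integral_eq_lintegral_ofReal (hwin2.const_mul _) (Eventually.of_forall hnn)).symm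
    _ = ENNReal.ofReal (∫ z, X z ^ 2 ∂G) := by
        rw [integral_const_mul, integral_window_eq c θ u Φ (X := fun w => X w ^ 2) hX2m hX2i hh.le,
          ← mul_assoc, inv_mul_cancel₀ hh.ne', one_mul]
    _ = ∫⁻ z, ENNReal.ofReal (X z ^ 2) ∂G :=
        ofReal_integral_eq_lintegral_ofReal hX2i (Eventually.of_forall fun z => sq_nonneg _)

/-- A.e.-measurability of the window integral `z ↦ ∫₀ʰ X(Φ_r z) dr` (it is integrable). [folklore] -/
theorem aemeasurable_window (c θ : ℝ) (u : V3)
    (Φ : HardSphereFlow (Torus.geometry (Fin 3)) (hsDiameter σ N) (N + 1))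
    [IsProbabilityMeasure (localGibbsLaw σ (fun _ => c) (fun _ => u) (fun _ => θ) N Φ)]
    {X : Config (N + 1) (Fin 3) T3 → ℝ} (hX : Measurable X)
    (hXi : Integrable X (localGibbsLaw σ (fun _ => c) (fun _ => u) (fun _ => θ) N Φ))
    {h : ℝ} (hh : 0 ≤ h) :
    AEMeasurable (fun z => ∫ r in (0 : ℝ)..h, X (Φ.flow r z))
      (localGibbsLaw σ (fun _ => c) (fun _ => u) (fun _ => θ) N Φ) :=
  (integrable_window c θ u Φ hX hXi hh).aestronglyMeasurable.aemeasurable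

/-- Invariance of `lintegral`s of (a.e.-measurable functions of) the datum under the flow:
`∫⁻ F(Φ_t z) dG_N = ∫⁻ F dG_N`. [folklore] -/
theorem lintegral_comp_flow_eq (c θ : ℝ) (u : V3)
    (Φ : HardSphereFlow (Torus.geometry (Fin 3)) (hsDiameter σ N) (N + 1))
    {F : Config (N + 1) (Fin 3) T3 → ℝ≥0∞}
    (hF : AEMeasurable F (localGibbsLaw σ (fun _ => c) (fun _ => u) (fun _ => θ) N Φ)) (t : ℝ) :
    ∫⁻ z, F (Φ.flow t z) ∂(localGibbsLaw σ (fun _ => c) (fun _ => u) (fun _ => θ) N Φ) =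
      ∫⁻ z, F z ∂(localGibbsLaw σ (fun _ => c) (fun _ => u) (fun _ => θ) N Φ) := by
  have hmap := map_flow_localGibbsLaw_const c θ u Φ t
  have hF' : AEMeasurable F ((localGibbsLaw σ (fun _ => c) (fun _ => u) (fun _ => θ) N Φ).map (Φ.flow t)) := by
    rw [hmap]; exact hF
  rw [← lintegral_map' hF' (Φ.measurable_flow t).aemeasurable, hmap]

end Ceiling

section Blocks

variable {σ : ℝ} {N : ℕ}

/-- Interval integrability on sub-intervals of `[0, H]` from integrability on `Ioc 0 H`. [folklore] -/
theorem intervalIntegrable_of_integrableOn_Ioc {f : ℝ → ℝ} {H a b : ℝ}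
    (hf : IntegrableOn f (Ioc (0 : ℝ) H)) (ha : 0 ≤ a) (hab : a ≤ b) (hb : b ≤ H) :
    IntervalIntegrable f volume a b := by
  rw [intervalIntegrable_iff_integrableOn_Ioc_of_le hab]
  exact hf.mono_set (Ioc_subset_Ioc ha hb)

/-- Cauchy–Schwarz for an interval integral: `(∫₀ʳ f)² ≤ r ∫₀ʳ f²` (`r ≥ 0`). [folklore] -/
theorem sq_integral_le_mul_integral_sq {f : ℝ → ℝ} {r : ℝ} (hr : 0 ≤ r)
    (hf : IntervalIntegrable f volume 0 r) (hf2 : IntervalIntegrable (fun s => f s ^ 2) volume 0 r) :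
    (∫ s in (0 : ℝ)..r, f s) ^ 2 ≤ r * ∫ s in (0 : ℝ)..r, f s ^ 2 := by
  rcases hr.eq_or_lt with h0 | hpos
  · subst h0; simp
  have h := sq_avg_le_avg_sq hpos hf hf2
  rw [mul_pow, inv_pow] at h
  have h2 : 0 ≤ ∫ s in (0 : ℝ)..r, f s ^ 2 := intervalIntegral.integral_nonneg hpos.le fun s _ => sq_nonneg _
  calc (∫ s in (0 : ℝ)..r, f s) ^ 2 = r ^ 2 * ((r ^ 2)⁻¹ * (∫ s in (0 : ℝ)..r, f s) ^ 2) := by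
        field_simp
    _ ≤ r ^ 2 * (r⁻¹ * ∫ s in (0 : ℝ)..r, f s ^ 2) := mul_le_mul_of_nonneg_left h (sq_nonneg _)
    _ = r * ∫ s in (0 : ℝ)..r, f s ^ 2 := by field_simp

/-- **Block decomposition of a window integral along a good orbit**: for `z` good, `h₀ > 0`, `k` blocks
and `h ≥ k h₀`, `∫₀ʰ X(Φ_s z) ds = Σ_{j<k} ∫₀^{h₀} X(Φ_s(Φ_{j h₀} z)) ds + ∫₀^{h − k h₀} X(Φ_s(Φ_{k h₀} z)) ds`
(additivity over adjacent intervals, translation of the variable, group property). [folklore] -/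
theorem window_integral_blocks (Φ : HardSphereFlow (Torus.geometry (Fin 3)) (hsDiameter σ N) (N + 1))
    {X : Config (N + 1) (Fin 3) T3 → ℝ} {z : Config (N + 1) (Fin 3) T3} (hz : z ∈ Φ.good)
    {H h₀ h : ℝ} (hh₀ : 0 < h₀) (k : ℕ) (hkh : (k : ℝ) * h₀ ≤ h) (hH : h ≤ H)
    (hint : IntegrableOn (fun r => X (Φ.flow r z)) (Ioc (0 : ℝ) H)) :
    ∫ s in (0 : ℝ)..h, X (Φ.flow s z) =
      (∑ j ∈ Finset.range k, ∫ s in (0 : ℝ)..h₀, X (Φ.flow s (Φ.flow ((j : ℝ) * h₀) z))) +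
        ∫ s in (0 : ℝ)..(h - k * h₀), X (Φ.flow s (Φ.flow ((k : ℝ) * h₀) z)) := by
  have hk0 : 0 ≤ (k : ℝ) * h₀ := by positivity
  -- shift identity on the good set
  have hshift : ∀ (t a : ℝ), ∫ s in (0 : ℝ)..a, X (Φ.flow s (Φ.flow t z)) = ∫ s in t..(a + t), X (Φ.flow s z) := by
    intro t a
    have e : (fun s => X (Φ.flow s (Φ.flow t z))) = fun s => X (Φ.flow (s + t) z) := by
      funext s; rw [Φ.flow_add s t z hz]
    rw [e, intervalIntegral.integral_comp_add_right (fun s => X (Φ.flow s z)) t, zero_add]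
  -- the blocks
  have hblocks : ∑ j ∈ Finset.range k, ∫ s in (0 : ℝ)..h₀, X (Φ.flow s (Φ.flow ((j : ℝ) * h₀) z)) =
      ∫ s in (0 : ℝ)..((k : ℝ) * h₀), X (Φ.flow s z) := by
    have e : ∀ j ∈ Finset.range k, ∫ s in (0 : ℝ)..h₀, X (Φ.flow s (Φ.flow ((j : ℝ) * h₀) z)) =
        ∫ s in ((j : ℝ) * h₀)..(((j + 1 : ℕ) : ℝ) * h₀), X (Φ.flow s z) := by
      intro j _
      rw [hshift]
      congr 1
      push_cast; ring
    rw [Finset.sum_congr rfl e]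
    have := intervalIntegral.sum_integral_adjacent_intervals (f := fun s => X (Φ.flow s z)) (μ := volume)
      (a := fun j : ℕ => (j : ℝ) * h₀) (n := k) (fun j hj => ?_)
    · simpa using this
    · refine intervalIntegrable_of_integrableOn_Ioc hint (by positivity) ?_ ?_
      · push_cast; nlinarith
      · have : ((j : ℝ) + 1) * h₀ ≤ (k : ℝ) * h₀ := by
          have hj' : (j : ℝ) + 1 ≤ k := by exact_mod_cast Nat.succ_le_of_lt hj
          nlinarith
        push_cast; linarith
  rw [hblocks, hshift, sub_add_cancel]
  exact (intervalIntegral.integral_add_adjacent_intervals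
    (intervalIntegrable_of_integrableOn_Ioc hint le_rfl hk0 (hkh.trans hH))
    (intervalIntegrable_of_integrableOn_Ioc hint hk0 hkh hH)).symm

/-- **Block sub-convexity of the kinetic-window variance.** For `X ∈ L²(G_N)` measurable, `h₀ > 0`,
`k ≥ 1` and a window `h` with `k h₀ ≤ h ≤ (k+1) h₀`:
`W(h) ≤ 2 W(h₀) + (2/k²) ∫⁻ ofReal(X²) dG_N`, `W(s) = ∫⁻ ofReal((s⁻¹∫₀ˢ X(Φ_r z) dr)²) dG_N`.
The `k` full blocks average `k` shifted copies of the `h₀`-window average (convexity + invariance give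
the first term, with the factor `2` from separating the remainder), and the remainder block of length
`≤ h₀` contributes at most `h₀²/h² ≤ 1/k²` times the static second moment (Cauchy–Schwarz +
stationarity). [folklore] -/
theorem lintegral_sq_window_le_of_le_of_le (c θ : ℝ) (u : V3)
    (Φ : HardSphereFlow (Torus.geometry (Fin 3)) (hsDiameter σ N) (N + 1))
    [IsProbabilityMeasure (localGibbsLaw σ (fun _ => c) (fun _ => u) (fun _ => θ) N Φ)]
    {X : Config (N + 1) (Fin 3) T3 → ℝ} (hX : Measurable X)
    (hX2 : MemLp X 2 (localGibbsLaw σ (fun _ => c) (fun _ => u) (fun _ => θ) N Φ))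
    {h₀ : ℝ} (hh₀ : 0 < h₀) {k : ℕ} (hk : 1 ≤ k) {h : ℝ} (hkh : (k : ℝ) * h₀ ≤ h)
    (hhk : h ≤ ((k : ℝ) + 1) * h₀) :
    ∫⁻ z, ENNReal.ofReal ((h⁻¹ * ∫ r in (0 : ℝ)..h, X (Φ.flow r z)) ^ 2)
        ∂(localGibbsLaw σ (fun _ => c) (fun _ => u) (fun _ => θ) N Φ) ≤
      2 * ∫⁻ z, ENNReal.ofReal ((h₀⁻¹ * ∫ r in (0 : ℝ)..h₀, X (Φ.flow r z)) ^ 2)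
          ∂(localGibbsLaw σ (fun _ => c) (fun _ => u) (fun _ => θ) N Φ) +
        ENNReal.ofReal (2 / (k : ℝ) ^ 2) *
          ∫⁻ z, ENNReal.ofReal (X z ^ 2) ∂(localGibbsLaw σ (fun _ => c) (fun _ => u) (fun _ => θ) N Φ) := by
  set G := localGibbsLaw σ (fun _ => c) (fun _ => u) (fun _ => θ) N Φ with hGdef
  have hkpos : (0 : ℝ) < k := by exact_mod_cast hk
  have hkh₀ : 0 < (k : ℝ) * h₀ := mul_pos hkpos hh₀
  have hhpos : 0 < h := hkh₀.trans_le hkh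
  set H := ((k : ℝ) + 1) * h₀ with hHdef
  set r := h - k * h₀ with hrdef
  have hr0 : 0 ≤ r := by rw [hrdef]; linarith
  have hrh₀ : r ≤ h₀ := by rw [hrdef]; linarith
  have hXi : Integrable X G := hX2.integrable one_le_two
  have hX2m : Measurable fun w => X w ^ 2 := hX.pow_const 2
  have hX2i : Integrable (fun w => X w ^ 2) G := hX2.integrable_sq
  -- a.e. good data with integrable sections on `[0, H]`
  have hsec : ∀ᵐ z ∂G, Integrable (fun s => X (Φ.flow s z)) (volume.restrict (Ioc (0 : ℝ) H)) :=
    (integrable_comp_flow_prod c θ u Φ hX hXi H).prod_left_ae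
  have hsec2 : ∀ᵐ z ∂G, Integrable (fun s => X (Φ.flow s z) ^ 2) (volume.restrict (Ioc (0 : ℝ) H)) :=
    (integrable_comp_flow_prod c θ u Φ hX2m hX2i H).prod_left_ae
  -- the window average at scale `h₀` and the remainder functional
  set I₀ : Config (N + 1) (Fin 3) T3 → ℝ := fun w => ∫ s in (0 : ℝ)..h₀, X (Φ.flow s w) with hI₀
  set C₀ : Config (N + 1) (Fin 3) T3 → ℝ := fun w => ∫ s in (0 : ℝ)..r, X (Φ.flow s w) ^ 2 with hC₀
  -- pointwise bound along good orbits
  have hpt : ∀ᵐ z ∂G, ENNReal.ofReal ((h⁻¹ * ∫ s in (0 : ℝ)..h, X (Φ.flow s z)) ^ 2) ≤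
      (∑ j ∈ Finset.range k, ENNReal.ofReal (2 / k) *
          ENNReal.ofReal ((h₀⁻¹ * I₀ (Φ.flow ((j : ℝ) * h₀) z)) ^ 2)) +
        ENNReal.ofReal (2 / ((k : ℝ) ^ 2 * h₀)) * ENNReal.ofReal (C₀ (Φ.flow ((k : ℝ) * h₀) z)) := by
    filter_upwards [ae_mem_good_localGibbsLaw' c θ u Φ, hsec, hsec2] with z hz hz1 hz2
    have hdec := window_integral_blocks Φ (X := X) hz hh₀ k hkh hhk hz1
    -- sections of the shifted orbits
    have hshiftfun : ∀ t : ℝ, (fun s => X (Φ.flow s (Φ.flow t z))) = fun s => X (Φ.flow (s + t) z) := by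
      intro t; funext s; rw [Φ.flow_add s t z hz]
    have hBint : IntervalIntegrable (fun s => X (Φ.flow s (Φ.flow ((k : ℝ) * h₀) z))) volume 0 r := by
      rw [hshiftfun]
      have h1 : IntervalIntegrable (fun s => X (Φ.flow s z)) volume (0 + (k : ℝ) * h₀) (r + (k : ℝ) * h₀) :=
        intervalIntegrable_of_integrableOn_Ioc hz1 (by positivity) (by linarith) (by rw [hrdef]; linarith)
      simpa using h1.comp_add_right ((k : ℝ) * h₀)
    have hBint2 : IntervalIntegrable (fun s => X (Φ.flow s (Φ.flow ((k : ℝ) * h₀) z)) ^ 2) volume 0 r := by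
      have e : (fun s => X (Φ.flow s (Φ.flow ((k : ℝ) * h₀) z)) ^ 2) = fun s => X (Φ.flow (s + (k : ℝ) * h₀) z) ^ 2 := by
        funext s; rw [Φ.flow_add s _ z hz]
      rw [e]
      have h1 : IntervalIntegrable (fun s => X (Φ.flow s z) ^ 2) volume (0 + (k : ℝ) * h₀) (r + (k : ℝ) * h₀) :=
        intervalIntegrable_of_integrableOn_Ioc hz2 (by positivity) (by linarith) (by rw [hrdef]; linarith)
      simpa using h1.comp_add_right ((k : ℝ) * h₀)
    set A : ℕ → ℝ := fun j => I₀ (Φ.flow ((j : ℝ) * h₀) z) with hA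
    set B : ℝ := ∫ s in (0 : ℝ)..r, X (Φ.flow s (Φ.flow ((k : ℝ) * h₀) z)) with hB
    have hdec' : ∫ s in (0 : ℝ)..h, X (Φ.flow s z) = (∑ j ∈ Finset.range k, A j) + B := by
      rw [hdec]
    -- Cauchy–Schwarz twice
    have hsumsq : (∑ j ∈ Finset.range k, A j) ^ 2 ≤ k * ∑ j ∈ Finset.range k, A j ^ 2 := by
      have := sq_sum_le_card_mul_sum_sq (s := Finset.range k) (f := A)
      simpa using this
    have hBsq : B ^ 2 ≤ r * C₀ (Φ.flow ((k : ℝ) * h₀) z) :=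
      sq_integral_le_mul_integral_sq hr0 hBint hBint2
    have hC₀nn : 0 ≤ C₀ (Φ.flow ((k : ℝ) * h₀) z) :=
      intervalIntegral.integral_nonneg hr0 fun s _ => sq_nonneg _
    have hsumnn : 0 ≤ ∑ j ∈ Finset.range k, A j ^ 2 := Finset.sum_nonneg fun j _ => sq_nonneg _
    -- the real inequality
    have hreal : (h⁻¹ * ∫ s in (0 : ℝ)..h, X (Φ.flow s z)) ^ 2 ≤
        (∑ j ∈ Finset.range k, 2 / k * (h₀⁻¹ * A j) ^ 2) +
          2 / ((k : ℝ) ^ 2 * h₀) * C₀ (Φ.flow ((k : ℝ) * h₀) z) := by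
      rw [hdec', mul_add]
      have h1 : (h⁻¹ * ∑ j ∈ Finset.range k, A j + h⁻¹ * B) ^ 2 ≤
          2 * (h⁻¹ * ∑ j ∈ Finset.range k, A j) ^ 2 + 2 * (h⁻¹ * B) ^ 2 := by
        nlinarith [sq_nonneg (h⁻¹ * ∑ j ∈ Finset.range k, A j - h⁻¹ * B)]
      refine h1.trans (add_le_add ?_ ?_)
      · -- first term: `2 h⁻² (Σ A)² ≤ 2 h⁻² k Σ A² ≤ (2/k) h₀⁻² Σ A²`
        have hh2 : h⁻¹ ^ 2 ≤ ((k : ℝ) * h₀)⁻¹ ^ 2 := by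
          rw [inv_pow, inv_pow]
          exact inv_anti₀ (by positivity) (pow_le_pow_left₀ hkh₀.le hkh 2)
        calc 2 * (h⁻¹ * ∑ j ∈ Finset.range k, A j) ^ 2
            = 2 * h⁻¹ ^ 2 * (∑ j ∈ Finset.range k, A j) ^ 2 := by ring
          _ ≤ 2 * ((k : ℝ) * h₀)⁻¹ ^ 2 * (k * ∑ j ∈ Finset.range k, A j ^ 2) :=
              mul_le_mul (mul_le_mul_of_nonneg_left hh2 (by norm_num)) hsumsq (sq_nonneg _) (by positivity)
          _ = ∑ j ∈ Finset.range k, 2 / k * (h₀⁻¹ * A j) ^ 2 := by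
              rw [Finset.mul_sum, Finset.mul_sum]
              refine Finset.sum_congr rfl fun j _ => ?_
              field_simp
      · -- remainder: `2 h⁻² B² ≤ 2 h⁻² r C₀ ≤ 2/(k² h₀) C₀`
        have hh2 : h⁻¹ ^ 2 * r ≤ 1 / ((k : ℝ) ^ 2 * h₀) := by
          rw [inv_pow, ← one_div, div_mul_eq_mul_div, one_mul, div_le_div_iff₀ (by positivity) (by positivity),
            one_mul]
          calc r * ((k : ℝ) ^ 2 * h₀) ≤ h₀ * ((k : ℝ) ^ 2 * h₀) := mul_le_mul_of_nonneg_right hrh₀ (by positivity)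
            _ = ((k : ℝ) * h₀) ^ 2 := by ring
            _ ≤ h ^ 2 := pow_le_pow_left₀ hkh₀.le hkh 2
        calc 2 * (h⁻¹ * B) ^ 2 = 2 * h⁻¹ ^ 2 * B ^ 2 := by ring
          _ ≤ 2 * h⁻¹ ^ 2 * (r * C₀ (Φ.flow ((k : ℝ) * h₀) z)) :=
              mul_le_mul_of_nonneg_left hBsq (by positivity)
          _ = 2 * (h⁻¹ ^ 2 * r) * C₀ (Φ.flow ((k : ℝ) * h₀) z) := by ring
          _ ≤ 2 * (1 / ((k : ℝ) ^ 2 * h₀)) * C₀ (Φ.flow ((k : ℝ) * h₀) z) :=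
              mul_le_mul_of_nonneg_right (mul_le_mul_of_nonneg_left hh2 (by norm_num)) hC₀nn
          _ = 2 / ((k : ℝ) ^ 2 * h₀) * C₀ (Φ.flow ((k : ℝ) * h₀) z) := by ring
    -- pass to `ℝ≥0∞`
    refine (ENNReal.ofReal_le_ofReal hreal).trans (le_of_eq ?_)
    rw [ENNReal.ofReal_add (Finset.sum_nonneg fun j _ => by positivity) (by positivity),
      ENNReal.ofReal_sum_of_nonneg fun j _ => by positivity]
    congr 1
    · refine Finset.sum_congr rfl fun j _ => ?_
      rw [ENNReal.ofReal_mul (by positivity)]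
    · rw [ENNReal.ofReal_mul (by positivity)]
  -- integrate the pointwise bound
  have hI₀m : AEMeasurable (fun w => ENNReal.ofReal ((h₀⁻¹ * I₀ w) ^ 2)) G :=
    (((aemeasurable_window c θ u Φ hX hXi hh₀.le).const_mul h₀⁻¹).pow_const 2).ennreal_ofReal
  have hC₀i : Integrable C₀ G := integrable_window c θ u Φ hX2m hX2i hr0
  have hC₀m : AEMeasurable (fun w => ENNReal.ofReal (C₀ w)) G := hC₀i.aestronglyMeasurable.aemeasurable.ennreal_ofReal
  have hterm1 : ∀ j : ℕ, ∫⁻ z, ENNReal.ofReal (2 / k) * ENNReal.ofReal ((h₀⁻¹ * I₀ (Φ.flow ((j : ℝ) * h₀) z)) ^ 2) ∂G =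
      ENNReal.ofReal (2 / k) * ∫⁻ z, ENNReal.ofReal ((h₀⁻¹ * I₀ z) ^ 2) ∂G := by
    intro j
    rw [lintegral_const_mul' _ _ ENNReal.ofReal_ne_top,
      lintegral_comp_flow_eq c θ u Φ (F := fun w => ENNReal.ofReal ((h₀⁻¹ * I₀ w) ^ 2)) hI₀m]
  have hterm2 : ∫⁻ z, ENNReal.ofReal (2 / ((k : ℝ) ^ 2 * h₀)) * ENNReal.ofReal (C₀ (Φ.flow ((k : ℝ) * h₀) z)) ∂G ≤
      ENNReal.ofReal (2 / (k : ℝ) ^ 2) * ∫⁻ z, ENNReal.ofReal (X z ^ 2) ∂G := by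
    rw [lintegral_const_mul' _ _ ENNReal.ofReal_ne_top,
      lintegral_comp_flow_eq c θ u Φ (F := fun w => ENNReal.ofReal (C₀ w)) hC₀m,
      ← ofReal_integral_eq_lintegral_ofReal hC₀i
        (Eventually.of_forall fun w => intervalIntegral.integral_nonneg hr0 fun s _ => sq_nonneg _),
      hC₀, integral_window_eq c θ u Φ (X := fun w => X w ^ 2) hX2m hX2i hr0,
      ← ofReal_integral_eq_lintegral_ofReal hX2i (Eventually.of_forall fun w => sq_nonneg _),
      ← ENNReal.ofReal_mul (by positivity), ← ENNReal.ofReal_mul (by positivity)]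
    refine ENNReal.ofReal_le_ofReal ?_
    have hI : 0 ≤ ∫ w, X w ^ 2 ∂G := integral_nonneg fun w => sq_nonneg _
    calc 2 / ((k : ℝ) ^ 2 * h₀) * (r * ∫ w, X w ^ 2 ∂G)
        ≤ 2 / ((k : ℝ) ^ 2 * h₀) * (h₀ * ∫ w, X w ^ 2 ∂G) :=
          mul_le_mul_of_nonneg_left (mul_le_mul_of_nonneg_right hrh₀ hI) (by positivity)
      _ = 2 / (k : ℝ) ^ 2 * ∫ w, X w ^ 2 ∂G := by field_simp
  have hmeas1 : ∀ j ∈ Finset.range k, AEMeasurable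
      (fun z => ENNReal.ofReal (2 / k) * ENNReal.ofReal ((h₀⁻¹ * I₀ (Φ.flow ((j : ℝ) * h₀) z)) ^ 2)) G := by
    intro j _
    have hmp := measurePreserving_flow_localGibbsLaw c θ u Φ ((j : ℝ) * h₀)
    have h' : AEMeasurable (fun w => ENNReal.ofReal ((h₀⁻¹ * I₀ w) ^ 2)) (G.map (Φ.flow ((j : ℝ) * h₀))) := by
      rw [hmp.map_eq]; exact hI₀m
    exact (h'.comp_aemeasurable hmp.measurable.aemeasurable).const_mul _
  calc ∫⁻ z, ENNReal.ofReal ((h⁻¹ * ∫ s in (0 : ℝ)..h, X (Φ.flow s z)) ^ 2) ∂G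
      ≤ ∫⁻ z, ((∑ j ∈ Finset.range k, ENNReal.ofReal (2 / k) *
            ENNReal.ofReal ((h₀⁻¹ * I₀ (Φ.flow ((j : ℝ) * h₀) z)) ^ 2)) +
          ENNReal.ofReal (2 / ((k : ℝ) ^ 2 * h₀)) * ENNReal.ofReal (C₀ (Φ.flow ((k : ℝ) * h₀) z))) ∂G :=
        lintegral_mono_ae hpt
    _ = (∑ j ∈ Finset.range k, ∫⁻ z, ENNReal.ofReal (2 / k) *
            ENNReal.ofReal ((h₀⁻¹ * I₀ (Φ.flow ((j : ℝ) * h₀) z)) ^ 2) ∂G) +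
          ∫⁻ z, ENNReal.ofReal (2 / ((k : ℝ) ^ 2 * h₀)) * ENNReal.ofReal (C₀ (Φ.flow ((k : ℝ) * h₀) z)) ∂G := by
        rw [lintegral_add_left' (Finset.aemeasurable_fun_sum _ hmeas1), lintegral_finsetSum' _ hmeas1]
    _ ≤ (∑ _j ∈ Finset.range k, ENNReal.ofReal (2 / k) * ∫⁻ z, ENNReal.ofReal ((h₀⁻¹ * I₀ z) ^ 2) ∂G) +
          ENNReal.ofReal (2 / (k : ℝ) ^ 2) * ∫⁻ z, ENNReal.ofReal (X z ^ 2) ∂G := by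
        refine add_le_add (le_of_eq (Finset.sum_congr rfl fun j _ => hterm1 j)) hterm2
    _ = 2 * ∫⁻ z, ENNReal.ofReal ((h₀⁻¹ * I₀ z) ^ 2) ∂G +
          ENNReal.ofReal (2 / (k : ℝ) ^ 2) * ∫⁻ z, ENNReal.ofReal (X z ^ 2) ∂G := by
        rw [Finset.sum_const, Finset.card_range, nsmul_eq_mul, ← mul_assoc]
        congr 2
        rw [← ENNReal.ofReal_natCast, ← ENNReal.ofReal_mul (by positivity),
          show ((k : ℝ)) * (2 / k) = 2 by field_simp]
        norm_num

end Blocks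

end EquilibriumStressVarianceDecayC3

end Summit.AtomisticToContinuum.HydrodynamicLimit.Theorems

end
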